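import Literature.IUT.HodgeTheaters.InitialThetaDataTorsionMonodromyModelProofs
import Mathlib.Topology.Instances.ZMod
import HarnessLib

/-!
# [IUTchI] §1 p. 37–38 / Def 3.1 (b)(c)(d) / [EtTh] Def 2.1: the SEMIDIRECT CLAIMS MODEL
# `Π_{C_F} := (ℤ/l × E_F[l](F̄)) ⋊ (G_F × {±1})` — a `π₁`-interface model carrying the `l`-torsion monodromy AND
# nontrivial cusp inertia (JOINT NV witness «{TorsionMonodromy, ArrowCoveringClaims, hI}», part 1: the group)

S. Mochizuki, *Inter-universal Teichmüller theory I*, kurims manuscript (May 2020), §1 p. 37 «the cusps of `X̲` …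
decomposition groups `D_x ⊆ Π_X̲` … inertia groups `I_x = D_x ∩ Δ`», p. 38 «`I_{ε′} ⥲ Δ_ε⁺`», §3 Definition 3.1 (b)
p. 61 «`X_F` … a once-punctured elliptic curve», «`C_F` … by the unique `F`-involution `−1`», (c) p. 62 «the image of
the outer homomorphism `G_F → GL₂(𝔽_l)` determined by the `l`-torsion points of `E_F` contains the subgroup
`SL₂(𝔽_l)`», (d) p. 62 «`C̲_K` is a hyperbolic orbicurve of type `(1, l-tors)±`»; [EtTh] Def 2.1 p. 36 «such that the
restricted map `Δ̄^ell_X → Q` is still surjective, but the restricted map `D_x → Q` is trivial»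
([IUTchI] Def 3.1 (b)(c)(d) p.61–62, §1 p.37–38) [claim: Mochizuki2012, status: disputed] (D-0012 claim key; series
status DISPUTED — this file CONSTRUCTS A MODEL of the cell's `π₁`-INTERFACE structures; nothing of the series is
asserted and no side is taken on [IUTchIII] Cor. 3.12).

## WHY (NV-L5 register, JOINT non-vacuity; abc-iut-w4-d077 gen 5 CLAIM 13:12Z)

abc-iut-L5-d5's derived local arrow law `InitialThetaData.localArrowLaw_local_of_torsionMonodromy M hA hI`
(p446888; (L1) p445209, (L2) p446471) and abc-iut-L5-t4's `baseKitOfTorsionMonodromy … M hA hI …` take THREE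
binders: a torsion monodromy `M` (abc-iut-L5-t8, NV #45 at `D₀.regeom`), the printed §1 claims `hA :
ArrowCoveringClaims` (NV at abc-iut-L5-t1-lineage's product model `pedClaimsOf`), and the (rel)-type law `hI`
«`τ(I_{ε′}) = 0`» (GAP G-L5d5g6-1).  No datum in the tree carries the SET: `regeom` has trivial cusp inertia, hence
refutes `hA` (`not_arrowCoveringClaims_of_inertia_ε1_eq_bot`, companion file), and a product model cannot carry `M`.
This file and its sequels build ONE datum carrying all three, so that the derived Λ FIRES non-vacuously.

## WHAT (this file = the normal factor, the action, `Π_{C_F}`, `Π_{X_F}`; sequels = `…ClaimsModelKLevel/Geometry/Proofs`)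

Normal factor `N := ℤ/l × E_F[l](F̄)` (multiplicative notation; abc-iut-L5-t8's `Tors`): the SECOND factor is the
genuine `l`-torsion with its Galois action and sign (`TorsionMonodromyModel.act`), the FIRST factor `W = ℤ/l` is a
SYNTHETIC INERTIA LINE on which `G_F × {±1}` acts trivially (print: the cusp inertia `≅ Ẑ(1)` dies in
`Δ_X^{ab} ⊗ 𝔽_l = E[l]`, and the involution fixes the inertia of a fixed cusp); `actN (σ, u) := id_W × act (σ, u)`,
jointly continuous; `PiC := N ⋊[actN] (G_F × ℤˣ)` profinite by abc-iut-L2's generic `SettingModel.Semidirect.*` API;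
`ext` = the augmentation `⟨n, (σ, u)⟩ ↦ σ` as a `FundamentalExtension` (abc-iut-L4-t1); `PiX := Ker(sgn)` (open,
normal, index `2`), so `Δ_X = N = W × E_F[l](F̄)` and the monodromy `τ := pr₂ ∘ left` kills `W`.

HONEST LABEL.  A MODEL of interface structures (consistency / joint non-vacuity evidence), not the étale fundamental
group of a curve: `Δ_X` is the finite group `ℤ/l × E_F[l](F̄)`, the inertia line is synthetic (rank one, `ι`-fixed),
only the `Π_{C_F}`-module `E_F[l](F̄)` is the curve's.  Instances are declared only on this file's model type `PiC`.
Instantiated ≠ endorsed; typed ≠ proved; no side taken on [IUTchIII] Cor. 3.12.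
-/

noncomputable section

namespace Literature.IUT.HodgeTheaters

namespace TorsionClaimsModel

open Literature.AnabelianGeometry.AbsoluteAnabelian Topology
open Literature.AnabelianGeometry.EtaleTheta.SettingModel
open TorsionMonodromyModel
open scoped WeierstrassCurve.Affine Classical

universe u

variable {F : Type u} [Field F] (E : WeierstrassCurve F) (Fbar : Type u) [Field Fbar] [Algebra F Fbar] (l : ℕ)

/-! ## The normal factor `N := ℤ/l × E_F[l](F̄)` and the action of `G_F × {±1}` -/
/-- **The model's normal factor `Δ_X := ℤ/l × E_F[l](F̄)`**: a synthetic inertia line `W = ℤ/l` times the genuine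
`l`-torsion (abc-iut-L5-t8's `Tors`), multiplicative notation, discrete topology (product of discrete factors).
[cite: Mochizuki2012, IUTchI §1 p.37] -/
abbrev N : Type u := Multiplicative (ZMod l) × Tors E Fbar l

variable (F) in
/-- **The action of `G_F × {±1}` on `N`**: trivial on the inertia line, `act (σ, u) = ρ(σ) ∘ (u·)` on `E_F[l](F̄)`.
[cite: Mochizuki2012, IUTchI Def 3.1 (c) p.62] -/
def actN : GalPM F Fbar →* MulAut (N E Fbar l) where
  toFun q := MulEquiv.prodCongr (MulEquiv.refl _) (act F E Fbar l q)
  map_one' := by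
    refine MulEquiv.ext fun x => Prod.ext rfl ?_
    show act F E Fbar l 1 x.2 = x.2
    rw [map_one, MulAut.one_apply]
  map_mul' q q' := by
    refine MulEquiv.ext fun x => Prod.ext rfl ?_
    show act F E Fbar l (q * q') x.2 = act F E Fbar l q (act F E Fbar l q' x.2)
    rw [map_mul, MulAut.mul_apply]

/-- `actN q (w, t) = (w, act q t)`: second coordinate. [cite: Mochizuki2012, IUTchI Def 3.1 (c) p.62] -/
@[simp] theorem actN_apply_snd (q : GalPM F Fbar) (x : N E Fbar l) :
    (actN F E Fbar l q x).2 = act F E Fbar l q x.2 := rfl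

/-- `actN q (w, t) = (w, act q t)`. [cite: Mochizuki2012, IUTchI Def 3.1 (c) p.62] -/
theorem actN_apply (q : GalPM F Fbar) (x : N E Fbar l) : actN F E Fbar l q x = (x.1, act F E Fbar l q x.2) := rfl

/-- The action is jointly continuous (`N` discrete; `act` jointly continuous by abc-iut-L5-t8's `continuous_act`).
[cite: Mochizuki2012, IUTchI Def 3.1 (c) p.62] -/
theorem continuous_actN [Algebra.IsAlgebraic F Fbar] [E.IsElliptic] [NeZero l] :
    Continuous fun q : GalPM F Fbar × N E Fbar l => actN F E Fbar l q.1 q.2 := by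
  have h1 : Continuous fun q : GalPM F Fbar × N E Fbar l => q.2.1 := continuous_fst.comp continuous_snd
  have key : (fun q : GalPM F Fbar × N E Fbar l => act F E Fbar l q.1 q.2.2) =
      (fun q : GalPM F Fbar × Tors E Fbar l => act F E Fbar l q.1 q.2) ∘
        (fun q : GalPM F Fbar × N E Fbar l => (q.1, q.2.2)) := rfl
  have h2 : Continuous fun q : GalPM F Fbar × N E Fbar l => act F E Fbar l q.1 q.2.2 := by
    rw [key]
    exact (continuous_act E Fbar l).comp (continuous_fst.prodMk (continuous_snd.comp continuous_snd))
  exact h1.prodMk h2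

/-- `σ ∈ G_F` fixing the `l`-torsion acts trivially on `N` (with trivial sign). [cite: Mochizuki2012, IUTchI Def 3.1 (c) p.62] -/
theorem actN_apply_of_fixesTorsion {σ : Fbar ≃ₐ[F] Fbar} (h : FixesTorsion E l σ) (x : N E Fbar l) :
    actN F E Fbar l (σ, 1) x = x := by
  refine Prod.ext rfl ?_
  rw [actN_apply_snd, act, MonoidHom.noncommCoprod_apply, map_one, mul_one, torsRep_apply_of_fixesTorsion E Fbar l h]

/-! ## `Π_{C_F} := N ⋊ (G_F × {±1})` as a profinite group; `Π_{C_F} ↠ G_F`; `Π_{X_F}` -/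

variable (F) in
/-- **The model `Π_{C_F} := (ℤ/l × E_F[l](F̄)) ⋊ (G_F × {±1})`**; a model type of this file.
[cite: Mochizuki2012, IUTchI Def 3.1 (b) p.61] -/
abbrev PiC : Type u := N E Fbar l ⋊[actN F E Fbar l] GalPM F Fbar

namespace PiC

/-- The topology of `Π_{C_F}`: induced along `g ↦ (g.left, g.right)` from `N × (G_F × {±1})`. [folklore] -/
instance instTopologicalSpace : TopologicalSpace (PiC F E Fbar l) :=
  TopologicalSpace.induced (fun g : PiC F E Fbar l => (g.left, g.right)) inferInstance

/-- `g ↦ (g.left, g.right)` is inducing (by definition of the topology). [cite: Mochizuki2012, IUTchI Def 3.1 (b) p.61] -/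
theorem isInducing : IsInducing fun g : PiC F E Fbar l => (g.left, g.right) := ⟨rfl⟩

/-- `Π_{C_F}` is a topological group (jointly continuous action). [folklore] -/
instance instIsTopologicalGroup [IsGalois F Fbar] [E.IsElliptic] [NeZero l] : IsTopologicalGroup (PiC F E Fbar l) :=
  Semidirect.isTopologicalGroup_of_continuous_action (isInducing E Fbar l) (continuous_actN E Fbar l)

/-- `Π_{C_F}` is compact (`N` finite, `G_F` profinite). [folklore] -/
instance instCompactSpace [IsGalois F Fbar] [E.IsElliptic] [NeZero l] : CompactSpace (PiC F E Fbar l) :=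
  Semidirect.compactSpace_of (isInducing E Fbar l)

/-- `Π_{C_F}` is totally disconnected. [folklore] -/
instance instTotallyDisconnectedSpace [IsGalois F Fbar] : TotallyDisconnectedSpace (PiC F E Fbar l) :=
  Semidirect.totallyDisconnectedSpace_of (isInducing E Fbar l)

end PiC

section Ext

variable [IsGalois F Fbar] [E.IsElliptic] [NeZero l]

variable (F) in
/-- **`Π_{C_F} ↠ G_F`** of the model as a `FundamentalExtension` (abc-iut-L4-t1): `⟨n, (σ, u)⟩ ↦ σ`, so
`Δ_C = N ⋊ (1 × {±1})`. [cite: Mochizuki2012, IUTchI Def 3.1 (b) p.61] -/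
def ext : FundamentalExtension.{u} where
  arith := ProfiniteGrp.of (PiC F E Fbar l)
  gal := ProfiniteGrp.of (Fbar ≃ₐ[F] Fbar)
  aug := (ContinuousMonoidHom.fst (Fbar ≃ₐ[F] Fbar) ℤˣ).comp (Semidirect.rightHomCont (PiC.isInducing E Fbar l))
  aug_surjective σ := ⟨SemidirectProduct.inr (σ, 1), rfl⟩

/-- The augmentation of the model: `aug ⟨n, (σ, u)⟩ = σ`. [cite: Mochizuki2012, IUTchI Def 3.1 (b) p.61] -/
@[simp] theorem ext_aug_apply (g : PiC F E Fbar l) : (ext F E Fbar l).aug g = g.right.1 := rfl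

/-- `Δ_C` of the model: `g ∈ Δ_C ↔ g.right.1 = 1`. [cite: Mochizuki2012, IUTchI Def 3.1 (b) p.61] -/
theorem mem_geom_ext_iff (g : PiC F E Fbar l) :
    (g : (ext F E Fbar l).arith) ∈ (ext F E Fbar l).geom ↔ g.right.1 = 1 :=
  (ext F E Fbar l).mem_geom

end Ext

variable (F) in
/-- `sgn : Π_{C_F} → Gal(X_F/C_F) = {±1}`, `⟨n, (σ, u)⟩ ↦ u`. [cite: Mochizuki2012, IUTchI Def 3.1 (b) p.61] -/
def sgn : PiC F E Fbar l →* ℤˣ := (MonoidHom.snd (Fbar ≃ₐ[F] Fbar) ℤˣ).comp SemidirectProduct.rightHom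

/-- [cite: Mochizuki2012, IUTchI Def 3.1 (b) p.61] -/
@[simp] theorem sgn_apply (g : PiC F E Fbar l) : sgn F E Fbar l g = g.right.2 := rfl

/-- `sgn` is surjective. [cite: Mochizuki2012, IUTchI Def 3.1 (b) p.61] -/
theorem sgn_surjective : Function.Surjective (sgn F E Fbar l) := fun u => ⟨SemidirectProduct.inr (1, u), rfl⟩

variable (F) in
/-- **`Π_{X_F} := Ker(sgn) = N ⋊ (G_F × 1)`** (`X_F → C_F` the quotient by `±1`). [cite: Mochizuki2012, IUTchI Def 3.1 (b) p.61] -/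
def PiX : Subgroup (PiC F E Fbar l) := (sgn F E Fbar l).ker

/-- [cite: Mochizuki2012, IUTchI Def 3.1 (b) p.61] -/
theorem mem_PiX_iff (g : PiC F E Fbar l) : g ∈ PiX F E Fbar l ↔ g.right.2 = 1 := Iff.rfl

/-- `Π_{X_F}` is normal. [cite: Mochizuki2012, IUTchI Def 3.1 (b) p.61] -/
theorem PiX_normal : (PiX F E Fbar l).Normal := inferInstanceAs (sgn F E Fbar l).ker.Normal

/-- `[Π_{C_F} : Π_{X_F}] = 2`. [cite: Mochizuki2012, IUTchI Def 3.1 (b) p.61] -/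
theorem PiX_index : (PiX F E Fbar l).index = 2 := by
  rw [PiX, Subgroup.index_ker, MonoidHom.range_eq_top.mpr (sgn_surjective E Fbar l), Subgroup.card_top,
    Nat.card_eq_fintype_card, Fintype.card_units_int]

/-- `Π_{X_F}` is open. [cite: Mochizuki2012, IUTchI Def 3.1 (b) p.61] -/
theorem PiX_isOpen : IsOpen (PiX F E Fbar l : Set (PiC F E Fbar l)) := by
  have h : (PiX F E Fbar l : Set (PiC F E Fbar l)) = (fun g : PiC F E Fbar l => g.right.2) ⁻¹' {1} := rfl
  rw [h]
  exact (isOpen_discrete _).preimage (continuous_snd.comp (Semidirect.continuous_right (PiC.isInducing E Fbar l)))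

/-- `inr (σ, 1) ∈ Π_{X_F}`. [cite: Mochizuki2012, IUTchI Def 3.1 (b) p.61] -/
theorem inr_mem_PiX (σ : Fbar ≃ₐ[F] Fbar) : (SemidirectProduct.inr (σ, 1) : PiC F E Fbar l) ∈ PiX F E Fbar l := rfl

/-- `inl n ∈ Π_{X_F}` (`N ⊆ Δ_X`). [cite: Mochizuki2012, IUTchI Def 3.1 (b) p.61] -/
theorem inl_mem_PiX (n : N E Fbar l) : (SemidirectProduct.inl n : PiC F E Fbar l) ∈ PiX F E Fbar l := rfl

/-! ## The finite factor `Dih := N ⋊ {±1}` of `Π_{C_K}` and its subgroups -/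

/-- **The sign action on `N`**: trivial on the inertia line, `t ↦ t^{±1}` on `E_F[l](F̄)`; `= actN (1, u)`.
[cite: Mochizuki2012, IUTchI Def 3.1 (b) p.61] -/
def sgnN : ℤˣ →* MulAut (N E Fbar l) := (actN F E Fbar l).comp (MonoidHom.inr (Fbar ≃ₐ[F] Fbar) ℤˣ)

/-- `sgnN u (w, t) = (w, t ^ u)`. [cite: Mochizuki2012, IUTchI Def 3.1 (b) p.61] -/
theorem sgnN_apply (u : ℤˣ) (x : N E Fbar l) : sgnN E Fbar l u x = (x.1, x.2 ^ (u : ℤ)) := by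
  show actN F E Fbar l (1, u) x = _
  rw [actN_apply, act, MonoidHom.noncommCoprod_apply, map_one, one_mul, sgnRep_apply_eq_zpow]

/-- **`Dih := N ⋊ {±1}`**, the finite factor of the model's `Π_{C_K} := G_K × Dih` (discrete); a model type of this
file. [cite: Mochizuki2012, IUTchI Def 3.1 (d) p.62] -/
abbrev Dih : Type u := N E Fbar l ⋊[sgnN E Fbar l] ℤˣ

namespace Dih

/-- The discrete topology on the finite factor. [folklore] -/
instance instTopologicalSpace : TopologicalSpace (Dih E Fbar l) := ⊥

/-- The topology is discrete by definition. [folklore] -/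
instance instDiscreteTopology : DiscreteTopology (Dih E Fbar l) := ⟨rfl⟩

/-- A discrete group is a topological group. [folklore] -/
instance instIsTopologicalGroup : IsTopologicalGroup (Dih E Fbar l) where
  continuous_mul := continuous_of_discreteTopology
  continuous_inv := continuous_of_discreteTopology

/-- `N ⋊ {±1}` is finite. [folklore] -/
instance instFinite [E.IsElliptic] [NeZero l] : Finite (Dih E Fbar l) :=
  Finite.of_equiv _ SemidirectProduct.equivProd.symm

/-- `#(N ⋊ {±1}) = 2·l·#E_F[l](F̄)`. [cite: Mochizuki2012, IUTchI Def 3.1 (d) p.62] -/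
theorem card [E.IsElliptic] [NeZero l] : Nat.card (Dih E Fbar l) = l * Nat.card (Tors E Fbar l) * 2 := by
  rw [Nat.card_congr SemidirectProduct.equivProd, Nat.card_prod, Nat.card_prod, Nat.card_eq_fintype_card (α := ℤˣ),
    Fintype.card_units_int, Nat.card_congr Multiplicative.toAdd, Nat.card_zmod]

variable {E Fbar l} in
/-- Commutators of elements of `N ⋊ 1` are trivial (`N` is commutative): condition (∗) of §1 at `k := K`.
[cite: Mochizuki2012, IUTchI §1 p.37] -/
theorem comm_eq_one {x y : Dih E Fbar l} (hx : x.right = 1) (hy : y.right = 1) : x * y * x⁻¹ * y⁻¹ = 1 := by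
  have hx' : x = SemidirectProduct.inl x.left := by
    rw [← SemidirectProduct.inl_left_mul_inr_right x, hx, map_one, mul_one, SemidirectProduct.left_inl]
  have hy' : y = SemidirectProduct.inl y.left := by
    rw [← SemidirectProduct.inl_left_mul_inr_right y, hy, map_one, mul_one, SemidirectProduct.left_inl]
  rw [hx', hy', ← map_inv, ← map_inv, ← map_mul, ← map_mul, ← map_mul, mul_inv_eq_one.mpr
    (mul_inv_eq_iff_eq_mul.mpr (mul_comm _ _)), map_one]

variable (F) {Fbar l}

/-- `dX := N ⋊ 1 = Ker(Dih → {±1})` (so `Π_{X_K} = G_K × dX`). [cite: Mochizuki2012, IUTchI Def 3.1 (d) p.62] -/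
def dX : Subgroup (Dih E Fbar l) := (SemidirectProduct.rightHom : Dih E Fbar l →* ℤˣ).ker

/-- `dC g := (W × ℤ·g) ⋊ {±1}` (so `Π_{C̲_K} = G_K × dC g`): inertia line, the line `ℤ·g`, the involution.
[cite: Mochizuki2012, IUTchI Def 3.1 (d) p.62] -/
def dC (g : Tors E Fbar l) : Subgroup (Dih E Fbar l) where
  carrier := {x | x.left.2 ∈ Subgroup.zpowers g}
  mul_mem' {x y} hx hy := by
    show (x * y).left.2 ∈ Subgroup.zpowers g
    rw [SemidirectProduct.mul_left, Prod.snd_mul, sgnN_apply]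
    exact mul_mem hx (Subgroup.zpow_mem _ hy _)
  one_mem' := by
    show (1 : Dih E Fbar l).left.2 ∈ Subgroup.zpowers g
    rw [SemidirectProduct.one_left, Prod.snd_one]
    exact one_mem _
  inv_mem' {x} hx := by
    show x⁻¹.left.2 ∈ Subgroup.zpowers g
    rw [SemidirectProduct.inv_left, sgnN_apply, Prod.snd_inv]
    exact Subgroup.zpow_mem _ (inv_mem hx) _

/-- `dXbar g := dX ∩ dC g = (W × ℤ·g) ⋊ 1` (so `Π_{X̲_K} = G_K × dXbar g`). [cite: Mochizuki2012, IUTchI Def 3.1 (d) p.62] -/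
def dXbar (g : Tors E Fbar l) : Subgroup (Dih E Fbar l) := dX F E ⊓ dC F E g

/-- `dW := (W × 1) ⋊ 1`, the SYNTHETIC INERTIA LINE of the model (the decomposition-group factor of the cusps
`ε⁰, ε′, ε″`). [cite: Mochizuki2012, IUTchI §1 p.37] -/
def dW : Subgroup (Dih E Fbar l) where
  carrier := {x | x.right = 1 ∧ x.left.2 = 1}
  mul_mem' {x y} hx hy := by
    refine ⟨by rw [SemidirectProduct.mul_right, hx.1, hy.1, mul_one], ?_⟩
    show (x * y).left.2 = 1
    rw [SemidirectProduct.mul_left, Prod.snd_mul, sgnN_apply, hy.2, one_zpow, hx.2, mul_one]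
  one_mem' := ⟨rfl, rfl⟩
  inv_mem' {x} hx := by
    refine ⟨by rw [SemidirectProduct.inv_right, hx.1, inv_one], ?_⟩
    show x⁻¹.left.2 = 1
    rw [SemidirectProduct.inv_left, sgnN_apply, Prod.snd_inv, hx.2, inv_one, one_zpow]

variable {F E}

/-- [cite: Mochizuki2012, IUTchI Def 3.1 (d) p.62] -/
theorem mem_dX_iff (x : Dih E Fbar l) : x ∈ dX F E ↔ x.right = 1 := Iff.rfl

/-- [cite: Mochizuki2012, IUTchI Def 3.1 (d) p.62] -/
theorem mem_dC_iff (g : Tors E Fbar l) (x : Dih E Fbar l) : x ∈ dC F E g ↔ x.left.2 ∈ Subgroup.zpowers g := Iff.rfl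

/-- [cite: Mochizuki2012, IUTchI Def 3.1 (d) p.62] -/
theorem mem_dXbar_iff (g : Tors E Fbar l) (x : Dih E Fbar l) :
    x ∈ dXbar F E g ↔ x.right = 1 ∧ x.left.2 ∈ Subgroup.zpowers g := Iff.rfl

/-- [cite: Mochizuki2012, IUTchI §1 p.37] -/
theorem mem_dW_iff (x : Dih E Fbar l) : x ∈ dW F E ↔ x.right = 1 ∧ x.left.2 = 1 := Iff.rfl

/-- The inertia line lies in `dXbar g` (`1 ∈ ℤ·g`). [cite: Mochizuki2012, IUTchI §1 p.37] -/
theorem dW_le_dXbar (g : Tors E Fbar l) : dW F E ≤ dXbar F E g := fun x hx =>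
  Subgroup.mem_inf.mpr ⟨hx.1, (mem_dC_iff g x).mpr (by rw [hx.2]; exact one_mem _)⟩

/-- `[Dih : dX] = 2`. [cite: Mochizuki2012, IUTchI Def 3.1 (d) p.62] -/
theorem dX_index : (dX F E : Subgroup (Dih E Fbar l)).index = 2 := by
  rw [dX, Subgroup.index_ker, MonoidHom.range_eq_top.mpr SemidirectProduct.rightHom_surjective, Subgroup.card_top,
    Nat.card_eq_fintype_card, Fintype.card_units_int]

/-- `#((W × ℤ·g) ⋊ {±1}) = l·l·2` (`g ≠ 1`, `l` prime). [cite: Mochizuki2012, IUTchI Def 3.1 (d) p.62] -/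
theorem card_dC [NeZero l] (hl : l.Prime) {g : Tors E Fbar l} (hg : g ≠ 1) :
    Nat.card ↥(dC F E g) = l * l * 2 := by
  let e : ↥(dC F E g) ≃ (Multiplicative (ZMod l) × ↥(Subgroup.zpowers g)) × ℤˣ :=
    { toFun := fun x => ((x.1.left.1, ⟨x.1.left.2, x.2⟩), x.1.right)
      invFun := fun p => ⟨⟨(p.1.1, (p.1.2 : Tors E Fbar l)), p.2⟩, p.1.2.2⟩
      left_inv := fun x => Subtype.ext (SemidirectProduct.ext rfl rfl)
      right_inv := fun p => Prod.ext (Prod.ext rfl (Subtype.ext rfl)) rfl }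
  rw [Nat.card_congr e, Nat.card_prod, Nat.card_prod, Tors.card_zpowers hl hg, Nat.card_eq_fintype_card (α := ℤˣ),
    Fintype.card_units_int, Nat.card_congr Multiplicative.toAdd, Nat.card_zmod]

/-- `#((W × ℤ·g) ⋊ 1) = l·l`. [cite: Mochizuki2012, IUTchI Def 3.1 (d) p.62] -/
theorem card_dXbar [NeZero l] (hl : l.Prime) {g : Tors E Fbar l} (hg : g ≠ 1) : Nat.card ↥(dXbar F E g) = l * l := by
  let e : ↥(dXbar F E g) ≃ Multiplicative (ZMod l) × ↥(Subgroup.zpowers g) :=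
    { toFun := fun x => (x.1.left.1, ⟨x.1.left.2, x.2.2⟩)
      invFun := fun a => ⟨SemidirectProduct.inl (a.1, (a.2 : Tors E Fbar l)), rfl, a.2.2⟩
      left_inv := fun x => Subtype.ext (SemidirectProduct.ext rfl x.2.1.symm)
      right_inv := fun a => Prod.ext rfl (Subtype.ext rfl) }
  rw [Nat.card_congr e, Nat.card_prod, Tors.card_zpowers hl hg, Nat.card_congr Multiplicative.toAdd, Nat.card_zmod]

/-- `#((W × 1) ⋊ 1) = l`. [cite: Mochizuki2012, IUTchI §1 p.37] -/
theorem card_dW [NeZero l] : Nat.card ↥(dW F E : Subgroup (Dih E Fbar l)) = l := by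
  let e : ↥(dW F E : Subgroup (Dih E Fbar l)) ≃ Multiplicative (ZMod l) :=
    { toFun := fun x => x.1.left.1
      invFun := fun a => ⟨SemidirectProduct.inl (a, 1), rfl, rfl⟩
      left_inv := fun x => Subtype.ext (SemidirectProduct.ext (Prod.ext rfl x.2.2.symm) x.2.1.symm)
      right_inv := fun a => rfl }
  rw [Nat.card_congr e, Nat.card_congr Multiplicative.toAdd, Nat.card_zmod]

variable [E.IsElliptic] [NeZero l]

/-- `[Dih : dC g] = l`. [cite: Mochizuki2012, IUTchI Def 3.1 (d) p.62] -/
theorem dC_index (hl : l.Prime) (hcard : Nat.card (Tors E Fbar l) = l ^ 2) {g : Tors E Fbar l} (hg : g ≠ 1) :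
    (dC F E g).index = l := by
  have h := Subgroup.card_mul_index (dC F E g)
  rw [card_dC hl hg, card, hcard] at h
  have h' : l * l * 2 * (dC F E g).index = l * l * 2 * l := by rw [h]; ring
  exact Nat.eq_of_mul_eq_mul_left (Nat.mul_pos (Nat.mul_pos hl.pos hl.pos) two_pos) h'

/-- `[Dih : dXbar g] = 2l`. [cite: Mochizuki2012, IUTchI Def 3.1 (d) p.62] -/
theorem dXbar_index (hl : l.Prime) (hcard : Nat.card (Tors E Fbar l) = l ^ 2) {g : Tors E Fbar l} (hg : g ≠ 1) :
    (dXbar F E g).index = l * 2 := by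
  have h := Subgroup.card_mul_index (dXbar F E g)
  rw [card_dXbar hl hg, card, hcard] at h
  have h' : l * l * (dXbar F E g).index = l * l * (l * 2) := by rw [h]; ring
  exact Nat.eq_of_mul_eq_mul_left (Nat.mul_pos hl.pos hl.pos) h'

/-- `[dX : dXbar g] = l`: the degree of `X̲_K → X_K`. [cite: Mochizuki2012, IUTchI Def 3.1 (d) p.62] -/
theorem dXbar_relIndex_dX (hl : l.Prime) (hcard : Nat.card (Tors E Fbar l) = l ^ 2) {g : Tors E Fbar l} (hg : g ≠ 1) :
    (dXbar F E g).relIndex (dX F E) = l := by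
  have hle : dXbar F E g ≤ dX F E := inf_le_left
  have h := Subgroup.relIndex_mul_index hle
  rw [dX_index, dXbar_index hl hcard hg] at h
  exact Nat.eq_of_mul_eq_mul_right two_pos h

/-- `[dC g : dXbar g] = 2`: the degree of `X̲_K → C̲_K`. [cite: Mochizuki2012, IUTchI Def 3.1 (d) p.62] -/
theorem dXbar_relIndex_dC (hl : l.Prime) (hcard : Nat.card (Tors E Fbar l) = l ^ 2) {g : Tors E Fbar l} (hg : g ≠ 1) :
    (dXbar F E g).relIndex (dC F E g) = 2 := by
  have hle : dXbar F E g ≤ dC F E g := inf_le_right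
  have h := Subgroup.relIndex_mul_index hle
  rw [dC_index hl hcard hg, dXbar_index hl hcard hg, mul_comm l 2] at h
  exact Nat.eq_of_mul_eq_mul_right hl.pos h

/-- `[dXbar g : dW] = l` (the inertia line has index `l` in `(W × ℤ·g) ⋊ 1`). [cite: Mochizuki2012, IUTchI §1 p.38] -/
theorem dW_relIndex_dXbar (hl : l.Prime) (hcard : Nat.card (Tors E Fbar l) = l ^ 2) {g : Tors E Fbar l}
    (hg : g ≠ 1) : (dW F E).relIndex (dXbar F E g) = l := by
  have hW : (dW F E : Subgroup (Dih E Fbar l)).index = l * l * 2 := by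
    have h := Subgroup.card_mul_index (dW F E : Subgroup (Dih E Fbar l))
    rw [card_dW, card, hcard] at h
    have h' : l * (dW F E : Subgroup (Dih E Fbar l)).index = l * (l * l * 2) := by rw [h]; ring
    exact Nat.eq_of_mul_eq_mul_left hl.pos h'
  have h := Subgroup.relIndex_mul_index (dW_le_dXbar (F := F) (E := E) g)
  rw [hW, dXbar_index hl hcard hg] at h
  have h' : (dW F E).relIndex (dXbar F E g) * (l * 2) = l * (l * 2) := by rw [h]; ring
  exact Nat.eq_of_mul_eq_mul_right (Nat.mul_pos hl.pos two_pos) h'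

omit [E.IsElliptic] [NeZero l] in
/-- `dC g ⊄ dX` (the involution `⟨1, −1⟩`): `C̲_K` is not a covering of `X_K`. [cite: Mochizuki2012, IUTchI Def 3.1 (d) p.62] -/
theorem not_dC_le_dX (g : Tors E Fbar l) : ¬ dC F E g ≤ dX F E := by
  intro h
  have hmem : (SemidirectProduct.inr (-1) : Dih E Fbar l) ∈ dC F E g := by
    rw [mem_dC_iff, SemidirectProduct.left_inr]
    exact one_mem _
  have h1 : (-1 : ℤˣ) = 1 := (mem_dX_iff _).mp (h hmem)
  exact absurd (congrArg Units.val h1) (by decide)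

end Dih

end TorsionClaimsModel

end Literature.IUT.HodgeTheaters

end
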